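import Summits.QuantumFields.YangMills.Theorems.BalabanUVNodesN27ReadOutAtU3OfKernels
import Literature.MathematicalPhysics.QuantumFieldTheory.Balaban1983to89.Node00.Record13CoPHChi
import Literature.MathematicalPhysics.QuantumFieldTheory.Balaban1983to89.Node00.U3OfKernelsChi

/-!
# BalabanUVNodes ∕ N27 = binder B5 — THE (D4) CLOSER AT THE χ-GENERIC KERNEL OBJECTS OF RECORD `objectsOfRecord₁₃Chi` ON THE χ-GENERIC STAGE-13 DATUM `datumOfRecord₁₃CoPHChi`,
# WITH THE RE-CENTRED («Ax») INSTANCE — op 5c supply row R16 for crux K3ᴬ `SpineGivenEndpointR13SepCoPHVAx` (stmt-QuantumFields-27247; plan g99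
# `D99-KAX/OP5C-SUPPLY-CENSUS-K3v8.md` §2 row 16 + σ5 «CONTENT RE-PINS»)

Cell `pub-ymgap`, seat `pub-ymgap-dag-n16-e` (R134 (a); dag-lead g40 HANDS-4: R16 falls to this seat absent a n27 hand), generation 30.  `--supports stmt-QuantumFields-27247
--as helper` (count-neutral).  NEW basename beside the UNTOUCHED parent `Thm/BalabanUVNodesN27ReadOutAtU3OfKernels` (dag-n27-w1 INTENT-5, ns `…BalabanUVNodes.N27ReadOutAtU3OfKernels`).

WHY THIS IS NOT A RENAME (this seat's ⚑ LOCATED, pub-ymgap INBOX l.21817, accepted by plan g99 σ5): the parent's `readOutAt_objectsOfRecord₁₃_coPH` concludes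
`ReadOutAt (datumOfRecord₁₃CoPH F N θ hP) (u3OfRecord₁₃ θ (objectsOfRecord₁₃ F N θ ℓ) k)` by identifying the datum's β-function `betaOfRecord₁₃ θ` with the (1.22) second moments
of the CHOICE-centred kernel objects `objectsOfRecord₁₃` (`Node00/U3OfKernels` :454, :480–497).  The re-centred datum `datumOfRecord₁₃CoPHAx` reads `betaOfRecord₁₃Ax θ`, which those
kernels do NOT represent; the coherent (D4) row pins node U3's objects to the kernels of the merged term family AT THE SAME β-SLOT the datum reads — `objectsOfRecord₁₃Chi θ χ ℓ`
(this seat's `Node00/U3OfKernelsChi`, ✓p802930), instance `objectsOfRecord₁₃Ax` — and then the parent's one-term proof goes through VERBATIM over the χ rows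
(`representsA∕B_objectsOfRecord₁₃_chi`, `βfun_datumOfRecord₁₃CoPH_chi`, `kernelDecayOfRecord₁₃Chi_iff`, `kernelDecayB_objectsOfRecord₁₃_chi`).

WHAT IS KERNEL-CHECKED (theorems only; 0 `def`, 0 `sorry`).  §1 ★★ `readOutAt_objectsOfRecord₁₃Chi_coPH` — (D4) at `datumOfRecord₁₃CoPHChi F N θ χ hP` on `objectsOfRecord₁₃Chi F N θ χ ℓ`
from `ℓ.Signs`, `0 < ℓ.κ`, `betaPrime510 4 1 ℓ.κ ≤ ℓ.cr` and ONE (5.10) clause `KernelDecayOfRecord₁₃Chi F N θ χ 0 1 ℓ.κ`; `forall_readOutAt_objectsOfRecord₁₃Chi_coPH` — the θ-keyed family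
form (any guard `G`, letter blocks `ℓ F θ`, centre maps `Χ F θ`).  §2 ★★ `readOutAt_objectsOfRecord₁₃Ax_coPH` ∕ `forall_readOutAt_objectsOfRecord₁₃Ax_coPH` — the Ax spellings
(`datumOfRecord₁₃CoPHAx`, `objectsOfRecord₁₃Ax`, `KernelDecayOfRecord₁₃Ax`; binder `θ.Provisos₁₃CoPHAx`) = the K3ᴬ v8 `readOutAt_rrOfRecord_of_pinned` callee under σ5-a.

HONEST FRAMING.  A REDUCTION, not a discharge: (D4) at the (re-centred) record ⟸ (5.10) for the limiting kernels of the merged term at that β-slot + letter inequalities;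
(5.10) is print's claim ([Balaban1987RG1] p. 293) and stays a HYPOTHESIS; the existence of the limit (1.21) is NOT asserted; NE4 ∕ NE5 ∕ NE9 NOT proved; N17 ∕ N27 NOT discharged;
K3ᴬ OPEN (skeleton unregistered at filing); counts UNMOVED (typed 28∕28 · discharged 8∕27, A 8∕28); standard axioms; one finite four-torus programme at fixed `ε` — NOT ℝ⁴, NOT
infinite volume, NOT OS, NOT a mass gap, NOT Clay.  No decl below carries a cite tag.
-/

noncomputable section

open scoped BigOperators

namespace Summit.QuantumFields.YangMills.BalabanUVNodes.N27ReadOutAtU3OfKernels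

open Literature.MathematicalPhysics.QuantumFieldTheory.Balaban1983to89
open Literature.MathematicalPhysics.QuantumFieldTheory.Balaban1983to89.T4Continuum
open Literature.MathematicalPhysics.QuantumFieldTheory.Balaban1983to89.T4OutputRate (Window)
open Literature.MathematicalPhysics.QuantumFieldTheory.Balaban1983to89.B12Sec2to5 (betaPrime510)
open Literature.MathematicalPhysics.QuantumFieldTheory.Balaban1983to89.Node00.U3OfKernels (objectsOfRecord₁₃Chi objectsOfRecord₁₃Ax pt bg scale_pt l1_le_d_pt
  representsA_objectsOfRecord₁₃_chi representsB_objectsOfRecord₁₃_chi KernelDecayOfRecord₁₃Chi KernelDecayOfRecord₁₃Ax kernelDecayOfRecord₁₃Chi_iff kernelDecayB_objectsOfRecord₁₃_chi)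
open YMDAG.UVSplit
open Node00 (Stage13Params Stage13HParams ChiSlot U3Letters₁₁ chiβOfRecord₁₃Ax datumOfRecord₁₃CoPHChi datumOfRecord₁₃CoPHAx)
open Summit.QuantumFields.YangMills.BalabanUVNodes.N27ReadOutAtOfKernelSlices (readOutAt_u3OfRecord₁₃_of_kernelSlices)

variable {F : T4Family} {N : ℕ} [NeZero N]

/-! ## §1 At the χ-generic Stage-13 datum on the χ-generic kernel objects of record -/

/-- ★★ **(D4) AT THE χ-GENERIC STAGE-13 DATUM `datumOfRecord₁₃CoPHChi F N θ χ hP` ON THE χ-GENERIC KERNEL OBJECTS `objectsOfRecord₁₃Chi F N θ χ ℓ`** (objects, window and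
(5.10) clause read at `θ.toStage13Params`; the β-face `(datumOfRecord₁₃CoPHChi F N θ χ hP).βfun = betaOfRecord₁₃Chi F N θ.toStage13Params χ` is `Node00.βfun_datumOfRecord₁₃CoPH_chi`,
`rfl`, and `RepresentsA∕B` for `betaOfRecord₁₃Chi` hold BY CONSTRUCTION at `objectsOfRecord₁₃Chi`).  From `ℓ.Signs`, `0 < ℓ.κ`, `betaPrime510 4 1 ℓ.κ ≤ ℓ.cr` and ONE (5.10) clause
`KernelDecayOfRecord₁₃Chi F N θ χ 0 1 ℓ.κ`; NOT a discharge. [bookkeeping] -/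
theorem readOutAt_objectsOfRecord₁₃Chi_coPH (θ : Stage13HParams F N) (χ : ChiSlot F N) (hP : θ.Provisos₁₃CoPHChi F N χ) (ℓ : U3Letters₁₁) (hs : ℓ.Signs)
    (hκ : 0 < ℓ.κ) (hcr : betaPrime510 4 1 ℓ.κ ≤ ℓ.cr) (k : ℕ) (hdec : KernelDecayOfRecord₁₃Chi F N θ.toStage13Params χ 0 1 ℓ.κ) :
    ReadOutAt (datumOfRecord₁₃CoPHChi F N θ χ hP) (u3OfRecord₁₃ θ.toStage13Params (objectsOfRecord₁₃Chi F N θ.toStage13Params χ ℓ) k) := by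
  have hA := representsA_objectsOfRecord₁₃_chi F N θ.toStage13Params χ ℓ k
  have hB := representsB_objectsOfRecord₁₃_chi F N θ.toStage13Params χ ℓ k
  rw [← Node00.βfun_datumOfRecord₁₃CoPH_chi F N θ χ hP] at hA hB
  exact readOutAt_u3OfRecord₁₃_of_kernelSlices θ.toStage13Params (objectsOfRecord₁₃Chi F N θ.toStage13Params χ ℓ) hs k (datumOfRecord₁₃CoPHChi F N θ χ hP) 0 1 pt bg
    scale_pt l1_le_d_pt hκ hcr hA hB ((kernelDecayOfRecord₁₃Chi_iff F N θ.toStage13Params χ ℓ k 0 1 ℓ.κ).1 hdec)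
    (kernelDecayB_objectsOfRecord₁₃_chi F N θ.toStage13Params χ ℓ k hdec)

/-- **THE θ-KEYED FAMILY FORM, χ-generic** (any guard `G`, letter blocks `ℓ F θ`, centre maps `Χ F θ` read at the tuple): the `hD4`-binder SHAPE of the N27 composers for a
centre-map-generic U3 reading keyed on `objectsOfRecord₁₃Chi … (Χ F θ) …` — from per-tuple signs, `0 < κ`, `betaPrime510 4 1 κ ≤ cr` and the χ-(5.10) clause.  NOT a discharge. [bookkeeping] -/
theorem forall_readOutAt_objectsOfRecord₁₃Chi_coPH (Χ : (F : T4Family) → Stage13Params F N → ChiSlot F N) (G : ∀ {F : T4Family}, Stage13HParams F N → Prop)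
    (ℓ : (F : T4Family) → Stage13HParams F N → U3Letters₁₁)
    (hs : ∀ (F : T4Family) (θ : Stage13HParams F N), θ.Provisos₁₃CoPHChi F N (Χ F θ.toStage13Params) → G θ → θ.Admissible F N → (ℓ F θ).Signs)
    (hκ : ∀ (F : T4Family) (θ : Stage13HParams F N), θ.Provisos₁₃CoPHChi F N (Χ F θ.toStage13Params) → G θ → θ.Admissible F N → 0 < (ℓ F θ).κ)
    (hcr : ∀ (F : T4Family) (θ : Stage13HParams F N), θ.Provisos₁₃CoPHChi F N (Χ F θ.toStage13Params) → G θ → θ.Admissible F N →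
      betaPrime510 4 1 (ℓ F θ).κ ≤ (ℓ F θ).cr)
    (hdec : ∀ (F : T4Family) (θ : Stage13HParams F N), θ.Provisos₁₃CoPHChi F N (Χ F θ.toStage13Params) → G θ → θ.Admissible F N →
      KernelDecayOfRecord₁₃Chi F N θ.toStage13Params (Χ F θ.toStage13Params) 0 1 (ℓ F θ).κ) :
    ∀ (F : T4Family) (θ : Stage13HParams F N) (hP : θ.Provisos₁₃CoPHChi F N (Χ F θ.toStage13Params)), G θ → θ.Admissible F N → ∀ k : ℕ,
      ReadOutAt (datumOfRecord₁₃CoPHChi F N θ (Χ F θ.toStage13Params) hP)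
        (u3OfRecord₁₃ θ.toStage13Params (objectsOfRecord₁₃Chi F N θ.toStage13Params (Χ F θ.toStage13Params) (ℓ F θ)) k) :=
  fun F θ hP hG hθ k =>
    readOutAt_objectsOfRecord₁₃Chi_coPH θ (Χ F θ.toStage13Params) hP (ℓ F θ) (hs F θ hP hG hθ) (hκ F θ hP hG hθ) (hcr F θ hP hG hθ) k (hdec F θ hP hG hθ)

/-! ## §2 The RE-CENTRED instance, spelled (the K3ᴬ v8 `readOutAt_rrOfRecord_of_pinned` callee after σ5-a) -/

/-- ★★ **(D4) AT THE RE-CENTRED STAGE-13 DATUM `datumOfRecord₁₃CoPHAx F N θ hP` ON THE RE-CENTRED KERNEL OBJECTS `objectsOfRecord₁₃Ax F N θ ℓ`** — §1 at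
`χ := chiβOfRecord₁₃Ax θ` (binder `hP : θ.Provisos₁₃CoPHAx F N`; (5.10) clause `KernelDecayOfRecord₁₃Ax`).  NOT a discharge. [bookkeeping] -/
theorem readOutAt_objectsOfRecord₁₃Ax_coPH (θ : Stage13HParams F N) (hP : θ.Provisos₁₃CoPHAx F N) (ℓ : U3Letters₁₁) (hs : ℓ.Signs) (hκ : 0 < ℓ.κ)
    (hcr : betaPrime510 4 1 ℓ.κ ≤ ℓ.cr) (k : ℕ) (hdec : KernelDecayOfRecord₁₃Ax F N θ.toStage13Params 0 1 ℓ.κ) :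
    ReadOutAt (datumOfRecord₁₃CoPHAx F N θ hP) (u3OfRecord₁₃ θ.toStage13Params (objectsOfRecord₁₃Ax F N θ.toStage13Params ℓ) k) :=
  readOutAt_objectsOfRecord₁₃Chi_coPH θ (chiβOfRecord₁₃Ax F N θ.toStage13Params) hP ℓ hs hκ hcr k hdec

/-- **THE θ-KEYED FAMILY FORM AT THE RE-CENTRED RECORD** (any guard `G`, letter blocks `ℓ F θ`). NOT a discharge. [bookkeeping] -/
theorem forall_readOutAt_objectsOfRecord₁₃Ax_coPH (G : ∀ {F : T4Family}, Stage13HParams F N → Prop) (ℓ : (F : T4Family) → Stage13HParams F N → U3Letters₁₁)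
    (hs : ∀ (F : T4Family) (θ : Stage13HParams F N), θ.Provisos₁₃CoPHAx F N → G θ → θ.Admissible F N → (ℓ F θ).Signs)
    (hκ : ∀ (F : T4Family) (θ : Stage13HParams F N), θ.Provisos₁₃CoPHAx F N → G θ → θ.Admissible F N → 0 < (ℓ F θ).κ)
    (hcr : ∀ (F : T4Family) (θ : Stage13HParams F N), θ.Provisos₁₃CoPHAx F N → G θ → θ.Admissible F N → betaPrime510 4 1 (ℓ F θ).κ ≤ (ℓ F θ).cr)
    (hdec : ∀ (F : T4Family) (θ : Stage13HParams F N), θ.Provisos₁₃CoPHAx F N → G θ → θ.Admissible F N →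
      KernelDecayOfRecord₁₃Ax F N θ.toStage13Params 0 1 (ℓ F θ).κ) :
    ∀ (F : T4Family) (θ : Stage13HParams F N) (hP : θ.Provisos₁₃CoPHAx F N), G θ → θ.Admissible F N → ∀ k : ℕ,
      ReadOutAt (datumOfRecord₁₃CoPHAx F N θ hP) (u3OfRecord₁₃ θ.toStage13Params (objectsOfRecord₁₃Ax F N θ.toStage13Params (ℓ F θ)) k) :=
  fun F θ hP hG hθ k => readOutAt_objectsOfRecord₁₃Ax_coPH θ hP (ℓ F θ) (hs F θ hP hG hθ) (hκ F θ hP hG hθ) (hcr F θ hP hG hθ) k (hdec F θ hP hG hθ)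

end Summit.QuantumFields.YangMills.BalabanUVNodes.N27ReadOutAtU3OfKernels

end
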